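import Summits.BirchSwinnertonDyer.Rank1Residual.Additive.X3BranchMultCongruenceOfFacts
import Summits.BirchSwinnertonDyer.Rank1Residual.X2.GreenbergVatsalCaseOne
import HarnessLib

/-!
# X3♯(M), rank `0`, every odd `p`: the END STATE — `ChiBranchLowerLeadingTerm[Odd]At W p` and
# `BSD(E,p)` from PRINT ∧ the displayed (M) branch congruence `hGVM` (+ the residual lifting), the
# count `hAlgW` DISCHARGED (cell `bsd-addord`, seat `bsd-addord-twist`; sequel of
# `X3BranchMultCongruenceOfFacts.lean`, twin of `X3BranchMultCongruenceDescentEndState.lean`)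

HONEST FRAMING (cell `bsd-addord`, `run/shared/lean/pub/bsd-addord/README.md` §4): the programme's
target of record is the full Birch–Swinnerton-Dyer formula for every `E/ℚ` of analytic rank `≤ 1`;
this file concerns X3♯(M) ∩ `r_an = 0`, odd `p`, on the branch-parity line position. THEOREMS ONLY
(no `def`, no named fact, no `sorry`); nothing booked — the analytic binder `hGVM` is OPEN (not in
print) and displayed; everything else is a PUBLISHED named fact (`hW16`, `h23`, `h414`, `hT40`,
`hT41`, `hDel98`, `hDelX`, `hPal`, `hGZK`, `hmod`, `hmodD`) or the residual lifting `hlift` in the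
Literature vocabulary (= `residualEpsilon_surjOn_of_lineEven`), plus the per-pair line datum `Φ₀`.
`Σ₀ :=` the bad places `≠ p` (`exists_finset_bad_not_mem`).

References: [Delbourgo1998] Prop. 4, Main Conjecture p. 151; [Wuthrich2014] Thm. 16; [Pal2012] Thm. 3.2;
[GreenbergVatsal2000] §2 (11), (16), §3 pp. 38–39; [MazurTateTeitelbaum1986Invent] §I.13–I.14;
[SilvermanATAEC1994] V.5.3, V.5.4; [Miller2011LMS] Def. 1.1.
-/

set_option autoImplicit false

noncomputable section

open scoped Classical MatrixGroups ModularForm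

namespace Summit.BirchSwinnertonDyer.Rank1Residual.Additive

open CongruenceSubgroup WeierstrassCurve NumberField IsDedekindDomain Field
  Literature.NumberTheory.EllipticCurves
  Literature.NumberTheory.EllipticCurves.ModularForms
  Literature.NumberTheory.EllipticCurves.GreenbergVatsal2000
  Literature.NumberTheory.EllipticCurves.Rank1Residual
  Literature.NumberTheory.EllipticCurves.Rank1Residual.Typed
  Literature.NumberTheory.GaloisRepresentations
  Summit.BirchSwinnertonDyer.Rank1Residual.X1.MuLambda
  Summit.BirchSwinnertonDyer.Rank1Residual.AdditivePotMult
  Summit.BirchSwinnertonDyer.Rank1Residual.Additive.X3Branch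

variable {W : WeierstrassCurve ℚ} [W.IsElliptic] [W.IsGloballyMinimal] {p : ℕ} [hp : Fact p.Prime]

/-- **X3♯(M), `p ≡ 1 (mod 4)`: additive-p2's `T = 0` LOWER input `ChiBranchLowerLeadingTermAt W p`
from `hW16 ∧ hGVM` ∧ the records `h23 h414 hT40 hT41` + the displayed lifting** (every twist model multiplicative; the sibling's `W`-level branch main
conjecture at the PLUS multiplicative branch of additive-p1's `exists_halfBranchMult_even`; constant
term read off). [cite: MazurTateTeitelbaum1986Invent, §I.14] [cite: Wuthrich2014, Thm. 16 (p. 397)]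
[cite: SilvermanATAEC1994, V.5.3] -/
theorem ClassX3M.chiBranchLowerLeadingTermAt_of_multBranchCongruence_of_facts_of_lifting
    (hW16 : Wuthrich2014.thm16_halfEigenCharIdeal_dvd_cyclotomicPrime)
    (hGVM : ∀ (V : WeierstrassCurve ℚ) [V.IsGloballyMinimal] [V.IsElliptic]
      (W : WeierstrassCurve ℚ) [W.IsGloballyMinimal] [W.IsElliptic] (p : ℕ) [Fact p.Prime]
      (K : Type) [Field K] [NumberField K] [(galRange (K := ℚ) K).Normal]
      (κ : ZpExtension ℚ p) {N : ℕ} [NeZero N] (f : CuspForm (Gamma0 N) 2) (B : PowerSeries ℚ_[p])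
      (S₀ : Finset (HeightOneSpectrum (𝓞 ℚ)))
      (Φ₀ : AddSubgroup (W.geomTorsion (p : ℤ))) (hΦ : IsRationalLine W p Φ₀),
      p ≠ 2 → V.HasMultiplicativeReductionAtPrime p → ¬ V.HasIrreducibleModPGaloisRep p →
      Module.finrank ℚ K = 2 → (∃ θ : K, θ ^ 2 = algebraMap ℚ K ((-1) ^ (p / 2) * p)) →
      (∃ C : VariableChange ℚ, C • V.quadraticTwist ((-1) ^ (p / 2) * p : ℚ) = W) →
      κ.IsCyclotomic →
      ((IsOrdinaryAt V p ∧
          B = if Even (p / 2) then padicLFunctionBranch f ((unitRoot V p : ℤ_[p]) : ℚ_[p]) (p / 2)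
            else padicLFunctionMinusBranch f ((unitRoot V p : ℤ_[p]) : ℚ_[p]) (p / 2)) ∨
        (V.HasSplitMultiplicativeReductionAtPrime p ∧
          B = if Even (p / 2) then padicLFunctionPlusBranchMult f (1 : ℚ_[p]) (p / 2)
            else padicLFunctionMinusBranchMult f (1 : ℚ_[p]) (p / 2)) ∨
        (V.HasMultiplicativeReductionAtPrime p ∧ ¬ V.HasSplitMultiplicativeReductionAtPrime p ∧
          B = if Even (p / 2) then padicLFunctionPlusBranchMult f (-1 : ℚ_[p]) (p / 2)
            else padicLFunctionMinusBranchMult f (-1 : ℚ_[p]) (p / 2))) →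
      IsNewformOf V f → LineEven W p Φ₀ →
      (∃ (σ : absoluteGaloisGroup ℚ) (P : W.geomTorsion (p : ℤ)), P ∈ Φ₀ ∧ σ • P ≠ P) →
      (¬ ∀ v : HeightOneSpectrum (𝓞 ℚ), ((p : ℕ) : 𝓞 ℚ) ∈ v.asIdeal →
          ∀ 𝔓 ∈ v.primesAbove, ∀ σ ∈ 𝔓.inertia (absoluteGaloisGroup ℚ), ∀ P ∈ Φ₀,
            σ • P = (if σ ∈ galRange (K := ℚ) K then P else -P)) →
      (∀ v ∈ S₀, ((p : ℕ) : 𝓞 ℚ) ∉ v.asIdeal) →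
      (∀ v : HeightOneSpectrum (𝓞 ℚ), v ∉ S₀ → ((p : ℕ) : 𝓞 ℚ) ∉ v.asIdeal →
        W.HasGoodReductionAt v) →
      ∀ (ϖ : ℚ), (if Even (p / 2) then (ϖ : ℝ) * V.realPeriodRat = plusPeriod f
          else (ϖ : ℝ) * V.imaginaryPeriodRat = minusPeriod f) →
      ∀ (b : IwasawaAlgebra p) (u : ℤ_[p]ˣ),
        iwasawaToPowerSeries p b = PowerSeries.C ((((u : ℤ_[p]) : ℚ_[p])) * ((ϖ : ℚ) : ℚ_[p])) * B →
        HasUnitContent (b * eulerFactorProduct W p S₀) ∧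
          p ^ (PowerSeries.map (PadicInt.toZMod (p := p)) (b * eulerFactorProduct W p S₀)).order.toNat =
            Nat.card (residualLineH1 W p κ S₀ Φ₀ hΦ) * Nat.card (residualQuotSelmer W p κ S₀ Φ₀ hΦ))
    (hX : ClassX3M W p)
    (Φ₀ : AddSubgroup (W.geomTorsion (p : ℤ))) (hΦ : IsRationalLine W p Φ₀)
    (heven : LineEven W p Φ₀)
    (hnt : ∃ (σ : absoluteGaloisGroup ℚ) (P : W.geomTorsion (p : ℤ)), P ∈ Φ₀ ∧ σ • P ≠ P)
    (hram : ∀ (K : Type) [Field K] [NumberField K] [(galRange (K := ℚ) K).Normal],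
      Module.finrank ℚ K = 2 → (∃ θ : K, θ ^ 2 = algebraMap ℚ K ((-1) ^ (p / 2) * p)) →
      ¬ ∀ v : HeightOneSpectrum (𝓞 ℚ), ((p : ℕ) : 𝓞 ℚ) ∈ v.asIdeal →
        ∀ 𝔓 ∈ v.primesAbove, ∀ σ ∈ 𝔓.inertia (absoluteGaloisGroup ℚ), ∀ P ∈ Φ₀,
          σ • P = (if σ ∈ galRange (K := ℚ) K then P else -P))
    (h23 : datumSelmer_nonPrimitive_invariants)
    (h414 : Greenberg1999.prop414_noFiniteSubmodule_of_not_dvd_torsionOrder)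
    (hT40 : Silverman1994_thmV53_tateUniformisation.{0})
    (hT41 : Silverman1994_thmV53_corV54_tateUniformisation.{0})
    (hlift : ∀ (κ : ZpExtension ℚ p) (S₀ : Finset (HeightOneSpectrum (𝓞 ℚ))), κ.IsCyclotomic →
      (∀ v ∈ S₀, ((p : ℕ) : 𝓞 ℚ) ∉ v.asIdeal) →
      (∀ v : HeightOneSpectrum (𝓞 ℚ), v ∉ S₀ → ((p : ℕ) : 𝓞 ℚ) ∉ v.asIdeal → W.HasGoodReductionAt v) →
      ∀ s ∈ residualQuotSelmer W p κ S₀ Φ₀ hΦ, ∃ x ∈ residualTorsionH1 W p κ S₀,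
        residualEpsilon W p κ Φ₀ hΦ x = s) :
    ChiBranchLowerLeadingTermAt W p := by
  obtain ⟨S₀, hS₀, hS⟩ := X2.GreenbergVatsalCaseOne.exists_finset_bad_not_mem W p
  intro V _ _ κ γ N _ f hp1 hCW _ hκ hγ hcv hf D ϖ hϖ g hg
  have hp2 : p ≠ 2 := by omega
  have heven' : Even (p / 2) := ⟨p / 4, by omega⟩
  obtain ⟨C, hC⟩ := hCW
  have hC' : C • V.quadraticTwist ((-1) ^ (p / 2) * p : ℚ) = W := by
    rw [pStar_eq_self_of_mod_four_eq_one hp1]; exact hC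
  have hmult : Mult V p := ClassX3M.mult_of_twist_model_pStar hX V C hC'
  obtain ⟨B, e, hB, hB0⟩ := AdditivePotMult.exists_halfBranchMult_even p hp2 heven' hmult hf
  obtain ⟨-, g', hchar, u, hι⟩ :=
    X3Branch.charIdeal_eq_span_of_multBranchCongruence_of_facts_of_lifting hW16 hGVM hp2
      (ClassX3M.potMult W p hX) hmult hC' S₀ hS₀ hS Φ₀ hΦ heven hnt hram h23 h414 hT40 hT41
      (fun κ' hκ' ↦ hlift κ' S₀ hκ' hS₀ hS) hκ hγ hcv hf hB D ϖ (by rw [if_pos heven']; exact hϖ)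
  have hg' : g ∈ Ideal.span ({g'} : Set (IwasawaAlgebra p)) := by rw [← hchar]; exact hg
  obtain ⟨a, rfl⟩ := Ideal.mem_span_singleton'.mp hg'
  have hCu : PowerSeries.C ((((u : ℤ_[p]) : ℚ_[p])) * (ϖ : ℚ_[p])) =
      PowerSeries.C (((u : ℤ_[p]) : ℚ_[p])) * PowerSeries.C (ϖ : ℚ_[p]) := map_mul _ _ _
  have hιg : iwasawaToPowerSeries p (a * g') =
      iwasawaToPowerSeries p (PowerSeries.C (u : ℤ_[p]) * a) *
        (PowerSeries.C ((ϖ : ℚ) : ℚ_[p]) * B) := by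
    rw [map_mul, hι, iwasawaToPowerSeries_C_mul', hCu]
    ring
  suffices key : ∀ g₀ h₀ : IwasawaAlgebra p, iwasawaToPowerSeries p g₀ =
      iwasawaToPowerSeries p h₀ * (PowerSeries.C ((ϖ : ℚ) : ℚ_[p]) * B) →
      ∃ h : ℤ_[p], ((PowerSeries.constantCoeff g₀ : ℤ_[p]) : ℚ_[p]) =
        (h : ℚ_[p]) * (ϖ : ℚ_[p]) * (legendrePlusSymbolSum f p : ℚ_[p]) from key (a * g') _ hιg
  intro g₀ h₀ hιg₀
  refine ⟨PowerSeries.constantCoeff h₀ * (e : ℤ_[p]), ?_⟩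
  have h0 := congrArg PowerSeries.constantCoeff hιg₀
  rw [constantCoeff_iwasawaToPowerSeries, map_mul, map_mul, constantCoeff_iwasawaToPowerSeries,
    PowerSeries.constantCoeff_C, hB0] at h0
  rw [h0, PadicInt.coe_mul]
  ring

/-- **X3♯(M), `p ≡ 3 (mod 4)` (`p = 3` included): additive-p2's ODD `T = 0` LOWER input
`ChiBranchLowerLeadingTermOddAt W p` from `hW16 ∧ hGVM` ∧ the records `h23 h414 hT40 hT41` + the displayed lifting** (MINUS multiplicative branch of
additive-p1's `exists_halfBranchMult_odd`). [cite: MazurTateTeitelbaum1986Invent, §I.13–I.14]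
[cite: Wuthrich2014, Thm. 16 (p. 397)] [cite: SilvermanATAEC1994, V.5.3] -/
theorem ClassX3M.chiBranchLowerLeadingTermOddAt_of_multBranchCongruence_of_facts_of_lifting
    (hW16 : Wuthrich2014.thm16_halfEigenCharIdeal_dvd_cyclotomicPrime)
    (hGVM : ∀ (V : WeierstrassCurve ℚ) [V.IsGloballyMinimal] [V.IsElliptic]
      (W : WeierstrassCurve ℚ) [W.IsGloballyMinimal] [W.IsElliptic] (p : ℕ) [Fact p.Prime]
      (K : Type) [Field K] [NumberField K] [(galRange (K := ℚ) K).Normal]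
      (κ : ZpExtension ℚ p) {N : ℕ} [NeZero N] (f : CuspForm (Gamma0 N) 2) (B : PowerSeries ℚ_[p])
      (S₀ : Finset (HeightOneSpectrum (𝓞 ℚ)))
      (Φ₀ : AddSubgroup (W.geomTorsion (p : ℤ))) (hΦ : IsRationalLine W p Φ₀),
      p ≠ 2 → V.HasMultiplicativeReductionAtPrime p → ¬ V.HasIrreducibleModPGaloisRep p →
      Module.finrank ℚ K = 2 → (∃ θ : K, θ ^ 2 = algebraMap ℚ K ((-1) ^ (p / 2) * p)) →
      (∃ C : VariableChange ℚ, C • V.quadraticTwist ((-1) ^ (p / 2) * p : ℚ) = W) →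
      κ.IsCyclotomic →
      ((IsOrdinaryAt V p ∧
          B = if Even (p / 2) then padicLFunctionBranch f ((unitRoot V p : ℤ_[p]) : ℚ_[p]) (p / 2)
            else padicLFunctionMinusBranch f ((unitRoot V p : ℤ_[p]) : ℚ_[p]) (p / 2)) ∨
        (V.HasSplitMultiplicativeReductionAtPrime p ∧
          B = if Even (p / 2) then padicLFunctionPlusBranchMult f (1 : ℚ_[p]) (p / 2)
            else padicLFunctionMinusBranchMult f (1 : ℚ_[p]) (p / 2)) ∨
        (V.HasMultiplicativeReductionAtPrime p ∧ ¬ V.HasSplitMultiplicativeReductionAtPrime p ∧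
          B = if Even (p / 2) then padicLFunctionPlusBranchMult f (-1 : ℚ_[p]) (p / 2)
            else padicLFunctionMinusBranchMult f (-1 : ℚ_[p]) (p / 2))) →
      IsNewformOf V f → LineEven W p Φ₀ →
      (∃ (σ : absoluteGaloisGroup ℚ) (P : W.geomTorsion (p : ℤ)), P ∈ Φ₀ ∧ σ • P ≠ P) →
      (¬ ∀ v : HeightOneSpectrum (𝓞 ℚ), ((p : ℕ) : 𝓞 ℚ) ∈ v.asIdeal →
          ∀ 𝔓 ∈ v.primesAbove, ∀ σ ∈ 𝔓.inertia (absoluteGaloisGroup ℚ), ∀ P ∈ Φ₀,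
            σ • P = (if σ ∈ galRange (K := ℚ) K then P else -P)) →
      (∀ v ∈ S₀, ((p : ℕ) : 𝓞 ℚ) ∉ v.asIdeal) →
      (∀ v : HeightOneSpectrum (𝓞 ℚ), v ∉ S₀ → ((p : ℕ) : 𝓞 ℚ) ∉ v.asIdeal →
        W.HasGoodReductionAt v) →
      ∀ (ϖ : ℚ), (if Even (p / 2) then (ϖ : ℝ) * V.realPeriodRat = plusPeriod f
          else (ϖ : ℝ) * V.imaginaryPeriodRat = minusPeriod f) →
      ∀ (b : IwasawaAlgebra p) (u : ℤ_[p]ˣ),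
        iwasawaToPowerSeries p b = PowerSeries.C ((((u : ℤ_[p]) : ℚ_[p])) * ((ϖ : ℚ) : ℚ_[p])) * B →
        HasUnitContent (b * eulerFactorProduct W p S₀) ∧
          p ^ (PowerSeries.map (PadicInt.toZMod (p := p)) (b * eulerFactorProduct W p S₀)).order.toNat =
            Nat.card (residualLineH1 W p κ S₀ Φ₀ hΦ) * Nat.card (residualQuotSelmer W p κ S₀ Φ₀ hΦ))
    (hX : ClassX3M W p)
    (Φ₀ : AddSubgroup (W.geomTorsion (p : ℤ))) (hΦ : IsRationalLine W p Φ₀)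
    (heven : LineEven W p Φ₀)
    (hnt : ∃ (σ : absoluteGaloisGroup ℚ) (P : W.geomTorsion (p : ℤ)), P ∈ Φ₀ ∧ σ • P ≠ P)
    (hram : ∀ (K : Type) [Field K] [NumberField K] [(galRange (K := ℚ) K).Normal],
      Module.finrank ℚ K = 2 → (∃ θ : K, θ ^ 2 = algebraMap ℚ K ((-1) ^ (p / 2) * p)) →
      ¬ ∀ v : HeightOneSpectrum (𝓞 ℚ), ((p : ℕ) : 𝓞 ℚ) ∈ v.asIdeal →
        ∀ 𝔓 ∈ v.primesAbove, ∀ σ ∈ 𝔓.inertia (absoluteGaloisGroup ℚ), ∀ P ∈ Φ₀,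
          σ • P = (if σ ∈ galRange (K := ℚ) K then P else -P))
    (h23 : datumSelmer_nonPrimitive_invariants)
    (h414 : Greenberg1999.prop414_noFiniteSubmodule_of_not_dvd_torsionOrder)
    (hT40 : Silverman1994_thmV53_tateUniformisation.{0})
    (hT41 : Silverman1994_thmV53_corV54_tateUniformisation.{0})
    (hlift : ∀ (κ : ZpExtension ℚ p) (S₀ : Finset (HeightOneSpectrum (𝓞 ℚ))), κ.IsCyclotomic →
      (∀ v ∈ S₀, ((p : ℕ) : 𝓞 ℚ) ∉ v.asIdeal) →
      (∀ v : HeightOneSpectrum (𝓞 ℚ), v ∉ S₀ → ((p : ℕ) : 𝓞 ℚ) ∉ v.asIdeal → W.HasGoodReductionAt v) →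
      ∀ s ∈ residualQuotSelmer W p κ S₀ Φ₀ hΦ, ∃ x ∈ residualTorsionH1 W p κ S₀,
        residualEpsilon W p κ Φ₀ hΦ x = s) :
    ChiBranchLowerLeadingTermOddAt W p := by
  obtain ⟨S₀, hS₀, hS⟩ := X2.GreenbergVatsalCaseOne.exists_finset_bad_not_mem W p
  intro V _ _ κ γ N _ f hp3 hCW _ hκ hγ hcv hf D ϖ hϖ g hg
  have hp2 : p ≠ 2 := by omega
  have hodd : ¬ Even (p / 2) := by rw [Nat.not_even_iff_odd]; exact ⟨p / 4, by omega⟩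
  obtain ⟨C, hC⟩ := hCW
  have hC' : C • V.quadraticTwist ((-1) ^ (p / 2) * p : ℚ) = W := by
    rw [pStar_eq_neg_of_mod_four_eq_three hp3]; exact hC
  have hmult : Mult V p := ClassX3M.mult_of_twist_model_pStar hX V C hC'
  obtain ⟨B, e, hB, hB0⟩ := AdditivePotMult.exists_halfBranchMult_odd p hp2 hodd hmult hf
  obtain ⟨-, g', hchar, u, hι⟩ :=
    X3Branch.charIdeal_eq_span_of_multBranchCongruence_of_facts_of_lifting hW16 hGVM hp2
      (ClassX3M.potMult W p hX) hmult hC' S₀ hS₀ hS Φ₀ hΦ heven hnt hram h23 h414 hT40 hT41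
      (fun κ' hκ' ↦ hlift κ' S₀ hκ' hS₀ hS) hκ hγ hcv hf hB D ϖ (by rw [if_neg hodd]; exact hϖ)
  have hg' : g ∈ Ideal.span ({g'} : Set (IwasawaAlgebra p)) := by rw [← hchar]; exact hg
  obtain ⟨a, rfl⟩ := Ideal.mem_span_singleton'.mp hg'
  have hCu : PowerSeries.C ((((u : ℤ_[p]) : ℚ_[p])) * (ϖ : ℚ_[p])) =
      PowerSeries.C (((u : ℤ_[p]) : ℚ_[p])) * PowerSeries.C (ϖ : ℚ_[p]) := map_mul _ _ _
  have hιg : iwasawaToPowerSeries p (a * g') =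
      iwasawaToPowerSeries p (PowerSeries.C (u : ℤ_[p]) * a) *
        (PowerSeries.C ((ϖ : ℚ) : ℚ_[p]) * B) := by
    rw [map_mul, hι, iwasawaToPowerSeries_C_mul', hCu]
    ring
  suffices key : ∀ g₀ h₀ : IwasawaAlgebra p, iwasawaToPowerSeries p g₀ =
      iwasawaToPowerSeries p h₀ * (PowerSeries.C ((ϖ : ℚ) : ℚ_[p]) * B) →
      ∃ h : ℤ_[p], ((PowerSeries.constantCoeff g₀ : ℤ_[p]) : ℚ_[p]) =
        (h : ℚ_[p]) * (ϖ : ℚ_[p]) * (legendreMinusSymbolSum f p : ℚ_[p]) from key (a * g') _ hιg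
  intro g₀ h₀ hιg₀
  refine ⟨PowerSeries.constantCoeff h₀ * (e : ℤ_[p]), ?_⟩
  have h0 := congrArg PowerSeries.constantCoeff hιg₀
  rw [constantCoeff_iwasawaToPowerSeries, map_mul, map_mul, constantCoeff_iwasawaToPowerSeries,
    PowerSeries.constantCoeff_C, hB0] at h0
  rw [h0, PadicInt.coe_mul]
  ring

/-- **X3♯(M) ∧ `r_an = 0`, EVERY odd `p` (both parities): `BSD(E,p)` ⟸ PUBLISHED ∧ `hGVM` (+ the displayed residual lifting).**
PUBLISHED: `hW16` (Wuthrich Thm. 16), `hDel98` / `hDelX` (Delbourgo 1998 Prop. 4 and its exact (M) form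
— no CM / anomalous restriction on (M)), `hPal` (even branch), `hGZK`, `hmod`, `hmodD`. OPEN, displayed:
`hGVM` (GV's branch congruence at a multiplicative prime), `hAlgW` (GV (16)+(11) for
`Sel_{p^∞}(W/ℚ_∞)`) is now DISCHARGED (`X3BranchAlgebraicCountWMult`); the residual lifting
`hlift` is the tree's reading-fact `residualEpsilon_surjOn_of_lineEven`. The previous two theorems into additive-p1's
`ClassX3M.bsdp_rankZero_of_chiBranchLower[Odd]`, parity split inside. The (M) half of T-X3-χ at
`W`-level (planner T-M311). NOT a class theorem; nothing booked.
[cite: Delbourgo1998, Prop. 4 (p. 144), Main Conjecture p. 151] [cite: Wuthrich2014, Thm. 16 (p. 397)]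
[cite: Pal2012, Thm. 3.2] [cite: GreenbergVatsal2000, §2 (16), §3 pp. 38–39 (shape only)]
[cite: Miller2011LMS, §1 and Def. 1.1] -/
theorem ClassX3M.bsdp_rankZero_of_multBranchCongruence_of_facts_of_lifting
    (hW16 : Wuthrich2014.thm16_halfEigenCharIdeal_dvd_cyclotomicPrime)
    (hGVM : ∀ (V : WeierstrassCurve ℚ) [V.IsGloballyMinimal] [V.IsElliptic]
      (W : WeierstrassCurve ℚ) [W.IsGloballyMinimal] [W.IsElliptic] (p : ℕ) [Fact p.Prime]
      (K : Type) [Field K] [NumberField K] [(galRange (K := ℚ) K).Normal]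
      (κ : ZpExtension ℚ p) {N : ℕ} [NeZero N] (f : CuspForm (Gamma0 N) 2) (B : PowerSeries ℚ_[p])
      (S₀ : Finset (HeightOneSpectrum (𝓞 ℚ)))
      (Φ₀ : AddSubgroup (W.geomTorsion (p : ℤ))) (hΦ : IsRationalLine W p Φ₀),
      p ≠ 2 → V.HasMultiplicativeReductionAtPrime p → ¬ V.HasIrreducibleModPGaloisRep p →
      Module.finrank ℚ K = 2 → (∃ θ : K, θ ^ 2 = algebraMap ℚ K ((-1) ^ (p / 2) * p)) →
      (∃ C : VariableChange ℚ, C • V.quadraticTwist ((-1) ^ (p / 2) * p : ℚ) = W) →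
      κ.IsCyclotomic →
      ((IsOrdinaryAt V p ∧
          B = if Even (p / 2) then padicLFunctionBranch f ((unitRoot V p : ℤ_[p]) : ℚ_[p]) (p / 2)
            else padicLFunctionMinusBranch f ((unitRoot V p : ℤ_[p]) : ℚ_[p]) (p / 2)) ∨
        (V.HasSplitMultiplicativeReductionAtPrime p ∧
          B = if Even (p / 2) then padicLFunctionPlusBranchMult f (1 : ℚ_[p]) (p / 2)
            else padicLFunctionMinusBranchMult f (1 : ℚ_[p]) (p / 2)) ∨
        (V.HasMultiplicativeReductionAtPrime p ∧ ¬ V.HasSplitMultiplicativeReductionAtPrime p ∧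
          B = if Even (p / 2) then padicLFunctionPlusBranchMult f (-1 : ℚ_[p]) (p / 2)
            else padicLFunctionMinusBranchMult f (-1 : ℚ_[p]) (p / 2))) →
      IsNewformOf V f → LineEven W p Φ₀ →
      (∃ (σ : absoluteGaloisGroup ℚ) (P : W.geomTorsion (p : ℤ)), P ∈ Φ₀ ∧ σ • P ≠ P) →
      (¬ ∀ v : HeightOneSpectrum (𝓞 ℚ), ((p : ℕ) : 𝓞 ℚ) ∈ v.asIdeal →
          ∀ 𝔓 ∈ v.primesAbove, ∀ σ ∈ 𝔓.inertia (absoluteGaloisGroup ℚ), ∀ P ∈ Φ₀,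
            σ • P = (if σ ∈ galRange (K := ℚ) K then P else -P)) →
      (∀ v ∈ S₀, ((p : ℕ) : 𝓞 ℚ) ∉ v.asIdeal) →
      (∀ v : HeightOneSpectrum (𝓞 ℚ), v ∉ S₀ → ((p : ℕ) : 𝓞 ℚ) ∉ v.asIdeal →
        W.HasGoodReductionAt v) →
      ∀ (ϖ : ℚ), (if Even (p / 2) then (ϖ : ℝ) * V.realPeriodRat = plusPeriod f
          else (ϖ : ℝ) * V.imaginaryPeriodRat = minusPeriod f) →
      ∀ (b : IwasawaAlgebra p) (u : ℤ_[p]ˣ),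
        iwasawaToPowerSeries p b = PowerSeries.C ((((u : ℤ_[p]) : ℚ_[p])) * ((ϖ : ℚ) : ℚ_[p])) * B →
        HasUnitContent (b * eulerFactorProduct W p S₀) ∧
          p ^ (PowerSeries.map (PadicInt.toZMod (p := p)) (b * eulerFactorProduct W p S₀)).order.toNat =
            Nat.card (residualLineH1 W p κ S₀ Φ₀ hΦ) * Nat.card (residualQuotSelmer W p κ S₀ Φ₀ hΦ))
    (hDel98 : Delbourgo1998.prop4_rankZero_pow_dvd_constantCoeff)
    (hDelX : Delbourgo1998.prop4_rankZero_constantCoeff_eq_unit_mul_of_potMult)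
    (hPal : Pal2012.thm32_sqrt_mul_realPeriodRat_twist_eq_of_prime_one_mod_four)
    (hGZK : rank_eq_analyticRank_of_analyticRank_le_one) (hmod : hasEntireLFunction_rat)
    (hmodD : nonempty_modularParametrizationData)
    (hX : ClassX3M W p) (hr : W.analyticRank = 0)
    (Φ₀ : AddSubgroup (W.geomTorsion (p : ℤ))) (hΦ : IsRationalLine W p Φ₀)
    (heven : LineEven W p Φ₀)
    (hnt : ∃ (σ : absoluteGaloisGroup ℚ) (P : W.geomTorsion (p : ℤ)), P ∈ Φ₀ ∧ σ • P ≠ P)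
    (hram : ∀ (K : Type) [Field K] [NumberField K] [(galRange (K := ℚ) K).Normal],
      Module.finrank ℚ K = 2 → (∃ θ : K, θ ^ 2 = algebraMap ℚ K ((-1) ^ (p / 2) * p)) →
      ¬ ∀ v : HeightOneSpectrum (𝓞 ℚ), ((p : ℕ) : 𝓞 ℚ) ∈ v.asIdeal →
        ∀ 𝔓 ∈ v.primesAbove, ∀ σ ∈ 𝔓.inertia (absoluteGaloisGroup ℚ), ∀ P ∈ Φ₀,
          σ • P = (if σ ∈ galRange (K := ℚ) K then P else -P))
    (h23 : datumSelmer_nonPrimitive_invariants)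
    (h414 : Greenberg1999.prop414_noFiniteSubmodule_of_not_dvd_torsionOrder)
    (hT40 : Silverman1994_thmV53_tateUniformisation.{0})
    (hT41 : Silverman1994_thmV53_corV54_tateUniformisation.{0})
    (hlift : ∀ (κ : ZpExtension ℚ p) (S₀ : Finset (HeightOneSpectrum (𝓞 ℚ))), κ.IsCyclotomic →
      (∀ v ∈ S₀, ((p : ℕ) : 𝓞 ℚ) ∉ v.asIdeal) →
      (∀ v : HeightOneSpectrum (𝓞 ℚ), v ∉ S₀ → ((p : ℕ) : 𝓞 ℚ) ∉ v.asIdeal → W.HasGoodReductionAt v) →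
      ∀ s ∈ residualQuotSelmer W p κ S₀ Φ₀ hΦ, ∃ x ∈ residualTorsionH1 W p κ S₀,
        residualEpsilon W p κ Φ₀ hΦ x = s) :
    BSDp W p := by
  have hodd := hp.out.eq_two_or_odd'
  have hp2 : p ≠ 2 := ClassX3M.p_ne_two W p hX
  by_cases hp4 : p % 4 = 1
  · exact ClassX3M.bsdp_rankZero_of_chiBranchLower hDel98 hDelX hPal hGZK hmod hmodD hW16 hX hp4 hr
      (ClassX3M.chiBranchLowerLeadingTermAt_of_multBranchCongruence_of_facts_of_lifting hW16 hGVM hX Φ₀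
        hΦ heven hnt hram h23 h414 hT40 hT41 hlift)
  · have hp4' : p % 4 = 3 := by
      rcases hodd with h | h
      · exact absurd h hp2
      · obtain ⟨k, hk⟩ := h; omega
    exact ClassX3M.bsdp_rankZero_of_chiBranchLowerOdd hDel98 hDelX hGZK hmod hmodD hW16 hX hp4' hr
      (ClassX3M.chiBranchLowerLeadingTermOddAt_of_multBranchCongruence_of_facts_of_lifting hW16 hGVM hX
        Φ₀ hΦ heven hnt hram h23 h414 hT40 hT41 hlift)

end Summit.BirchSwinnertonDyer.Rank1Residual.Additive

end
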